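import Literature.AlgebraicGeometry.Resolution.RegularLocalRingsProofs
import Summits.ResolutionOfSingularities.ResolutionOfSingularities.Theorems.WeightedInvariantHypersurfaceLocalGameEFT4SDimLETwo
import Summits.ResolutionOfSingularities.ResolutionOfSingularities.Theorems.WeightedInvariantHypersurfaceLocalGameEFT4SDimLETwoGameTerminal
import Summits.ResolutionOfSingularities.ResolutionOfSingularities.Theorems.WeightedInvariantHypersurfaceLocalGameEFTDimTwo
import Summits.ResolutionOfSingularities.ResolutionOfSingularities.Theorems.WeightedInvariantContactCentreFiltrationRegular
import Summits.ResolutionOfSingularities.ResolutionOfSingularities.Theorems.WeightedInvariantIotaOrderMonomialType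
import Summits.ResolutionOfSingularities.ResolutionOfSingularities.Theorems.WeightedInvariantHypersurfaceLocalGameEFT4SDimLETwoDimOne
import HarnessLib

/-!
# The P2 rung of `LocalWeightedDropEFT4S` for `(iotaOrd, jContact)`, game clause II: the body at Krull dimension two

Topic: `Summits/ResolutionOfSingularities/ResolutionOfSingularities/Theorems`. Helper for the door item
`HypersurfaceCentreConstruction` (statement `stmt-ResolutionOfSingularities-19897`, route `WeightedInvariant`);
ORDER (o24-G) of `res-L1-w43-plan-1` (2026-08-27T08:16:45Z), part 2 of 2: the BODY of the conjunct
`CanonicalGameClauseLE2 p iotaOrd jContact` of the P2 rung (`…EFT4SDimLETwo`, p512950) at positions of Krull dimension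
EXACTLY two — the `h2` input of res-type-025's combinator `canonicalGameClauseLE2_iotaOrd_of_dimTwo`
(`…EFT4SDimLETwoDimOne`, which supplies Krull dimension `≤ 1` from the P1 rung p510636).

[OURS · L1 W4.3] Replaces the role of NO printed item; NOT a statement of the manuscript
[claim: Hironaka2017, status: under-review]. AI work, weaker than expert review.

## Statement proved (`canonicalGameBody_iotaOrd_jContact_of_ringKrullDim_eq_two`)

`S` regular local of Krull dimension `2`, essentially of finite type over a field `k₀` (any field), `0 ≠ f ∈ 𝔪²`. Then the
body of `CanonicalGameClause` holds at `(S, f)` for `ι = iotaOrd` (res-type-073, p502169) and `J = jContact` (res-type-092,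
p514802): a prime `P` with `S ⧸ P` regular, (strat), (loc), and an honest weighted move `(u, w)` presenting `J`, with
centre `P`, admissible, and dropping `iotaOrd` over the whole centre germ.

* CASE A — `f = v·g^ν` of MONOMIAL TYPE (`canonicalGameBody_of_eq_unit_mul_pow`): `P = (g)`, `u = (x, g)`, `w = (0, 1)`,
  `J = (g)^m` (092 `jContact_of_eq_unit_mul_pow`); (strat)/(adm) = 073 `IotaOrderStrat.strat_adm_span_singleton_of_eq_unit_mul_pow`;
  (loc) = monomial type descends to `S_𝔭` (073 `exists_eq_unit_mul_pow_localization`); the successor conjunct is VACUOUS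
  (`LocalGameEFTDimTwoGame.isUnit_transform_of_monomialType`).
* CASE B — NOT of monomial type (`canonicalGameBody_of_not_isMonomialType`): `P = 𝔪`, `u = (x, y_T)`, `w = (1, b_T)` = the
  terminal system of the (o13) game WITH CERTIFICATE (`LocalGameEFTDimTwo.exists_terminal_of_not_associated_pow`, p515237);
  (strat)/(adm) = 073 `strat_maximalIdeal_of_forall_ne` / `adm_maximalIdeal`; (loc) = `jContact_isoInvariant` along
  `S ≃ S_𝔪`; (pres) = 092 `weightedMonomialIdeal_eq_jContact` with `bMax f = b_T`
  (`LocalGameEFTDimTwoGame.bMax_eq_of_terminal`, over 078's C1/C5); successor conjunct = the K7 drop.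

Finally `canonicalGameClauseLE2_iotaOrd_jContact (p) : CanonicalGameClauseLE2 p iotaOrd jContact` — THE (o24-G) CONJUNCT —
through res-type-025's combinator (`…EFT4SDimLETwoDimOne`).

## References

* J. Włodarczyk, *Functorial resolution by torus actions*, arXiv:2203.03090, §2.3.9, §3.3. [Wlodarczyk2022]
* H. Hironaka, *Characteristic polyhedra of singularities*, J. Math. Kyoto Univ. 7 (1967) 251–293. [Hironaka1967]
-/

noncomputable section

open IsLocalRing Literature.AlgebraicGeometry.Resolution
open Summit.ResolutionOfSingularities.ResolutionOfSingularities.Cruxes.HypersurfaceCentreConstruction.LocalEngine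

set_option linter.dupNamespace false -- mandated namespace of this single-conjunct summit

namespace Summit.ResolutionOfSingularities.ResolutionOfSingularities.Theorems

namespace LocalGameEFTDimTwoGame

variable {S : Type} [CommRing S]

/-! ### (loc) at the closed point: `S ≃ S_𝔪` -/

/-- **(loc) at the closed point.** For a local ring `S`, `S → S_𝔪` is an isomorphism, so
`jContact (S_𝔪) (f/1) m = (jContact S f m) S_𝔪` by (c6-J) `jContact_isoInvariant` (p515814). [folklore] -/
theorem jContact_localization_maximalIdeal_eq [IsLocalRing S] (f : S) (m : ℕ) :
    jContact (Localization.AtPrime (maximalIdeal S)) (algebraMap S (Localization.AtPrime (maximalIdeal S)) f) m =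
      (jContact S f m).map (algebraMap S (Localization.AtPrime (maximalIdeal S))) := by
  have hunits : (maximalIdeal S).primeCompl ≤ IsUnit.submonoid S := by
    intro s hs
    rw [IsUnit.mem_submonoid_iff]
    by_contra hnu
    exact hs ((IsLocalRing.mem_maximalIdeal s).mpr (mem_nonunits_iff.mpr hnu))
  let e : S ≃ₐ[S] Localization.AtPrime (maximalIdeal S) :=
    IsLocalization.atUnits S (maximalIdeal S).primeCompl hunits
  have he : ∀ s, e.toRingEquiv s = algebraMap S (Localization.AtPrime (maximalIdeal S)) s := fun s => by
    simpa using e.commutes s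
  have h := jContact_isoInvariant S (Localization.AtPrime (maximalIdeal S)) e.toRingEquiv f m
  rw [he] at h
  rw [h]
  unfold Ideal.map
  congr 1

/-! ### CASE A: monomial type -/

/-- **The game clause body in CASE A (monomial type), Krull dimension two.** `S` regular local with `spanFinrank 𝔪 = 2`,
`f = v·g^ν ∈ 𝔪²` with `v` a unit and `g ∈ 𝔪 ∖ 𝔪²`: centre `P = (g)`, move `u = (x, g)`, `w = (0, 1)` for any regular
system `(x, g)`, `J = (g)^m`; the successor conjunct is vacuous (the transform `v·(gt)^ν` is a unit off the vertex).
[OURS · L1 W4.3 · (o24-G)] -/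
theorem canonicalGameBody_of_eq_unit_mul_pow (S : Type) [CommRing S] [IsRegularLocalRing S]
    (hd : (maximalIdeal S).spanFinrank = 2) {v g : S} (hv : IsUnit v) (hg : g ∈ maximalIdeal S)
    (hg2 : g ∉ maximalIdeal S ^ 2) {ν : ℕ} {f : S} (hfe : f = v * g ^ ν) (hf2 : f ∈ (maximalIdeal S) ^ 2) :
    ∃ (P : Ideal S), P.IsPrime ∧ IsRegularLocalRing (S ⧸ P) ∧ f ∈ P ∧
      (∀ (𝔭 : Ideal S) [𝔭.IsPrime], f ∈ 𝔭 →
        (iotaOrd (Localization.AtPrime 𝔭) (algebraMap S (Localization.AtPrime 𝔭) f) = iotaOrd S f ↔ P ≤ 𝔭)) ∧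
      (∀ (𝔭 : Ideal S) [𝔭.IsPrime], f ∈ 𝔭 → P ≤ 𝔭 → ∀ m : ℕ,
        jContact (Localization.AtPrime 𝔭) (algebraMap S (Localization.AtPrime 𝔭) f) m =
          (jContact S f m).map (algebraMap S (Localization.AtPrime 𝔭))) ∧
      ∃ (n : ℕ) (u : Fin n → S) (w : Fin n → ℕ),
        Ideal.span (Set.range u) = maximalIdeal S ∧ (maximalIdeal S).spanFinrank = n ∧ (∃ i, 0 < w i) ∧
        Ideal.span {x | ∃ i, 0 < w i ∧ x = u i} = P ∧
        (∀ m : ℕ, weightedMonomialIdeal u w m = jContact S f m) ∧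
        (∀ (Q : Ideal S) [Q.IsPrime], P ≤ Q →
          algebraMap S (Localization.AtPrime Q) f ∈ (maximalIdeal (Localization.AtPrime Q)) ^ 2) ∧
        ∀ (𝔫 : Ideal (cobordantAlgebra' u w)) [𝔫.IsPrime],
          cobordantT' u w ∈ 𝔫 →
          P.map (algebraMap S (cobordantAlgebra' u w)) ≤ 𝔫 →
          ¬ (extReesAlgebra.vertexIdeal (weightedMonomialIdeal u w) ≤ 𝔫) →
          ∀ (a : ℕ) (g : cobordantAlgebra' u w),
            algebraMap S (cobordantAlgebra' u w) f = cobordantT' u w ^ a * g →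
            ¬ (cobordantT' u w ∣ g) →
            algebraMap (cobordantAlgebra' u w) (Localization.AtPrime 𝔫) g ∈
              (maximalIdeal (Localization.AtPrime 𝔫)) ^ 2 →
            iotaOrd (Localization.AtPrime 𝔫) (algebraMap (cobordantAlgebra' u w) (Localization.AtPrime 𝔫) g) <
              iotaOrd S f := by
  classical
  obtain ⟨hprime, hreg, hfg, hstrat, hadm⟩ :=
    IotaOrderStrat.strat_adm_span_singleton_of_eq_unit_mul_pow hv hg hg2 hfe hf2
  have hν2 : 2 ≤ ν := IotaOrderStrat.two_le_of_eq_unit_mul_pow_of_mem_sq hv hg hg2 hfe hf2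
  have hν1 : 1 ≤ ν := by omega
  have hJ : ∀ m, jContact S f m = Ideal.span {g} ^ m := fun m => by
    rw [hfe]; exact jContact_of_eq_unit_mul_pow S hv hg hg2 hν1 m
  obtain ⟨x, hxg⟩ := exists_span_pair_of_not_mem_sq hd hg hg2
  haveI := hprime
  refine ⟨Ideal.span {g}, hprime, hreg, hfg, hstrat, ?_, 2, ![x, g], ![0, 1],
    LocalGameEFTNewton.span_range_vecCons_eq hxg, hd, ⟨1, by simp⟩, ?_, ?_, hadm, ?_⟩
  · -- (loc): monomial type descends to `S_𝔭`
    intro 𝔭 _ hf𝔭 hle m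
    haveI : IsRegularLocalRing (Localization.AtPrime 𝔭) := isRegularLocalRing_localization_atPrime S 𝔭
    have hg𝔭 : g ∈ 𝔭 := hle (Ideal.mem_span_singleton_self g)
    obtain ⟨v', hv', hg𝔭m, hg𝔭2, hfe'⟩ := IotaOrderStrat.exists_eq_unit_mul_pow_localization hv hg hg2 hfe 𝔭 hg𝔭
    rw [hfe', jContact_of_eq_unit_mul_pow _ hv' hg𝔭m hg𝔭2 hν1 m, hJ m, Ideal.map_pow, Ideal.map_span,
      Set.image_singleton]
  · -- the centre of the move is `(g)`
    congr 1
    ext z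
    simp only [Set.mem_setOf_eq, Set.mem_singleton_iff]
    constructor
    · rintro ⟨i, hi, rfl⟩
      fin_cases i
      · simp at hi
      · simp
    · rintro rfl
      exact ⟨1, by simp, by simp⟩
  · -- (pres): `𝒥ₘ = (g)^m = J`
    intro m
    rw [weightedMonomialIdeal_vecCons_zero_one, hJ m]
  · -- the successor conjunct is vacuous: every transform is a unit off the vertex
    subst hfe
    intro 𝔫 _ _ _ hV a g' hfg' hndvd hg2'
    exfalso
    have hunit := isUnit_transform_of_monomialType' hg hg2 hv ν (weightedMonomialIdeal_vecCons_zero_one_eq_one x g)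
      𝔫 hV hfg' hndvd
    exact (mem_nonunits_iff.mp ((mem_maximalIdeal _).mp (Ideal.pow_le_self two_ne_zero hg2'))) hunit

/-! ### CASE B: not of monomial type -/

/-- **The game clause body in CASE B (not of monomial type), Krull dimension two.** `S` regular local of Krull dimension
`2`, essentially of finite type over a field, `0 ≠ f ∈ 𝔪²` NOT a unit times a power of a regular parameter: centre `P = 𝔪`,
move `u = (x, y_T)`, `w = (1, b_T)` — the TERMINAL system of the (o13) steepening game — presenting
`J = F_{y_T, b_max}` (`b_max = b_T`), admissible, and dropping `iotaOrd` at every singular successor point (K7).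
[OURS · L1 W4.3 · (o24-G)] -/
theorem canonicalGameBody_of_not_isMonomialType (S : Type) [CommRing S] [IsRegularLocalRing S]
    (k₀ : Type) [Field k₀] [Algebra k₀ S] [Algebra.EssFiniteType k₀ S]
    (hdim : ringKrullDim S = 2) (f : S) (hf0 : f ≠ 0) (hf2 : f ∈ (maximalIdeal S) ^ 2)
    (hnm : ¬ ∃ (v g : S) (ν : ℕ), IsUnit v ∧ g ∈ maximalIdeal S ∧ g ∉ maximalIdeal S ^ 2 ∧ f = v * g ^ ν) :
    ∃ (P : Ideal S), P.IsPrime ∧ IsRegularLocalRing (S ⧸ P) ∧ f ∈ P ∧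
      (∀ (𝔭 : Ideal S) [𝔭.IsPrime], f ∈ 𝔭 →
        (iotaOrd (Localization.AtPrime 𝔭) (algebraMap S (Localization.AtPrime 𝔭) f) = iotaOrd S f ↔ P ≤ 𝔭)) ∧
      (∀ (𝔭 : Ideal S) [𝔭.IsPrime], f ∈ 𝔭 → P ≤ 𝔭 → ∀ m : ℕ,
        jContact (Localization.AtPrime 𝔭) (algebraMap S (Localization.AtPrime 𝔭) f) m =
          (jContact S f m).map (algebraMap S (Localization.AtPrime 𝔭))) ∧
      ∃ (n : ℕ) (u : Fin n → S) (w : Fin n → ℕ),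
        Ideal.span (Set.range u) = maximalIdeal S ∧ (maximalIdeal S).spanFinrank = n ∧ (∃ i, 0 < w i) ∧
        Ideal.span {x | ∃ i, 0 < w i ∧ x = u i} = P ∧
        (∀ m : ℕ, weightedMonomialIdeal u w m = jContact S f m) ∧
        (∀ (Q : Ideal S) [Q.IsPrime], P ≤ Q →
          algebraMap S (Localization.AtPrime Q) f ∈ (maximalIdeal (Localization.AtPrime Q)) ^ 2) ∧
        ∀ (𝔫 : Ideal (cobordantAlgebra' u w)) [𝔫.IsPrime],
          cobordantT' u w ∈ 𝔫 →
          P.map (algebraMap S (cobordantAlgebra' u w)) ≤ 𝔫 →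
          ¬ (extReesAlgebra.vertexIdeal (weightedMonomialIdeal u w) ≤ 𝔫) →
          ∀ (a : ℕ) (g : cobordantAlgebra' u w),
            algebraMap S (cobordantAlgebra' u w) f = cobordantT' u w ^ a * g →
            ¬ (cobordantT' u w ∣ g) →
            algebraMap (cobordantAlgebra' u w) (Localization.AtPrime 𝔫) g ∈
              (maximalIdeal (Localization.AtPrime 𝔫)) ^ 2 →
            iotaOrd (Localization.AtPrime 𝔫) (algebraMap (cobordantAlgebra' u w) (Localization.AtPrime 𝔫) g) <
              iotaOrd S f := by
  classical
  have hd : (maximalIdeal S).spanFinrank = 2 := LocalGameEFTDimTwo.spanFinrank_eq_two hdim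
  have hdimS : ringKrullDim S = (2 : ℕ) := LocalGameEFTDimTwo.ringKrullDim_eq_two_nat hdim
  have hf : f ∈ maximalIdeal S := Ideal.pow_le_self two_ne_zero hf2
  -- the terminal system with certificate and drop (K7)
  obtain ⟨ν, hν2, hfν, hfν', hιν, x, y, b, hxy, hb, hcert, hdrop⟩ :=
    LocalGameEFTDimTwo.exists_terminal_of_not_associated_pow S k₀ hdim f hf0 hf2 hnm
  have hν1 : 1 ≤ ν := by omega
  -- (strat) with centre `𝔪`, and (adm)
  have hB : ∀ (v g : S) (n : ℕ), IsUnit v → g ∈ maximalIdeal S → g ∉ maximalIdeal S ^ 2 → f ≠ v * g ^ n :=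
    fun v g n hv hg hg2 hfe => hnm ⟨v, g, n, hv, hg, hg2, hfe⟩
  obtain ⟨-, hreg, -, hstrat⟩ := IotaOrderStrat.strat_maximalIdeal_of_forall_ne hdim.le hf0 hf hB
  -- (pres): the terminal level is `b_max`, reached through `y_T`
  have hbmax : bMax f = b := bMax_eq_of_terminal hd hxy hν1 hfν hfν' hb hcert
  have hreach : f ∈ contactFiltration y b (b * ν) := mem_contactFiltration_of_terminal hxy hfν hb hcert
  have hord : (adicOrder f).toNat = ν := by
    have h1 : (ν : ℕ∞) ≤ adicOrder f := (le_adicOrder_iff f ν).mpr hfν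
    have h2 : adicOrder f ≤ ν := (adicOrder_le_iff f ν).mpr hfν'
    rw [le_antisymm h2 h1, ENat.toNat_coe]
  have hy2 : y ∉ maximalIdeal S ^ 2 := (LocalGameEFTSteepening.not_mem_sq_of_span_pair_eq hdimS hxy).2
  have hpres : ∀ m, weightedMonomialIdeal ![x, y] ![1, b] m = jContact S f m := fun m => by
    have h := weightedMonomialIdeal_eq_jContact S hf0 hnm hxy hy2 (hbmax ▸ hb) (by rw [hbmax, hord]; exact hreach) m
    rwa [hbmax] at h
  refine ⟨maximalIdeal S, inferInstance, hreg, hf, hstrat, ?_, 2, ![x, y], ![1, b],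
    LocalGameEFTNewton.span_range_vecCons_eq hxy, hd, ⟨0, by simp⟩, ?_, hpres,
    fun Q _ hQ => IotaOrderStrat.adm_maximalIdeal hf2 Q hQ, ?_⟩
  · -- (loc): only `𝔭 = 𝔪`, where `S ≃ S_𝔪`
    intro 𝔭 _ _ hle m
    have h𝔭 : maximalIdeal S = 𝔭 := (IsLocalRing.maximalIdeal.isMaximal S).eq_of_le Ideal.IsPrime.ne_top' hle
    subst h𝔭
    exact jContact_localization_maximalIdeal_eq f m
  · -- the centre of the move is `𝔪 = (x, y_T)`
    rw [← hxy]
    congr 1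
    ext z
    simp only [Set.mem_setOf_eq, Set.mem_insert_iff, Set.mem_singleton_iff]
    constructor
    · rintro ⟨i, -, rfl⟩
      fin_cases i
      · simp
      · simp
    · rintro (rfl | rfl)
      · exact ⟨0, by simp, by simp⟩
      · exact ⟨1, Nat.lt_of_lt_of_le Nat.zero_lt_one (by simpa using hb), by simp⟩
  · -- the drop over the centre germ (= at the primes over `𝔪`): K7
    intro 𝔫 _ hT hP hV a g hfg hndvd hg2
    rw [hιν]
    exact hdrop 𝔫 hT hP hV a g hfg hndvd hg2

/-! ### The body at Krull dimension two -/

/-- **The body of `CanonicalGameClauseLE2 p iotaOrd jContact` at Krull dimension EXACTLY two** (the `h2` input of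
res-type-025's combinator `canonicalGameClauseLE2_iotaOrd_of_dimTwo`; the binders `CharP k₀ p` / `PerfectField k₀` of the
clause are idle and omitted): case A (monomial type) or case B. [OURS · L1 W4.3 · (o24-G)] -/
theorem canonicalGameBody_iotaOrd_jContact_of_ringKrullDim_eq_two
    (k₀ : Type) [Field k₀] (S : Type) [CommRing S] [Algebra k₀ S] [Algebra.EssFiniteType k₀ S] [IsRegularLocalRing S]
    (f : S) (hdim : ringKrullDim S = 2) (hf0 : f ≠ 0) (hf2 : f ∈ (maximalIdeal S) ^ 2) :
    ∃ (P : Ideal S), P.IsPrime ∧ IsRegularLocalRing (S ⧸ P) ∧ f ∈ P ∧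
      (∀ (𝔭 : Ideal S) [𝔭.IsPrime], f ∈ 𝔭 →
        (iotaOrd (Localization.AtPrime 𝔭) (algebraMap S (Localization.AtPrime 𝔭) f) = iotaOrd S f ↔ P ≤ 𝔭)) ∧
      (∀ (𝔭 : Ideal S) [𝔭.IsPrime], f ∈ 𝔭 → P ≤ 𝔭 → ∀ m : ℕ,
        jContact (Localization.AtPrime 𝔭) (algebraMap S (Localization.AtPrime 𝔭) f) m =
          (jContact S f m).map (algebraMap S (Localization.AtPrime 𝔭))) ∧
      ∃ (n : ℕ) (u : Fin n → S) (w : Fin n → ℕ),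
        Ideal.span (Set.range u) = maximalIdeal S ∧ (maximalIdeal S).spanFinrank = n ∧ (∃ i, 0 < w i) ∧
        Ideal.span {x | ∃ i, 0 < w i ∧ x = u i} = P ∧
        (∀ m : ℕ, weightedMonomialIdeal u w m = jContact S f m) ∧
        (∀ (Q : Ideal S) [Q.IsPrime], P ≤ Q →
          algebraMap S (Localization.AtPrime Q) f ∈ (maximalIdeal (Localization.AtPrime Q)) ^ 2) ∧
        ∀ (𝔫 : Ideal (cobordantAlgebra' u w)) [𝔫.IsPrime],
          cobordantT' u w ∈ 𝔫 →
          P.map (algebraMap S (cobordantAlgebra' u w)) ≤ 𝔫 →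
          ¬ (extReesAlgebra.vertexIdeal (weightedMonomialIdeal u w) ≤ 𝔫) →
          ∀ (a : ℕ) (g : cobordantAlgebra' u w),
            algebraMap S (cobordantAlgebra' u w) f = cobordantT' u w ^ a * g →
            ¬ (cobordantT' u w ∣ g) →
            algebraMap (cobordantAlgebra' u w) (Localization.AtPrime 𝔫) g ∈
              (maximalIdeal (Localization.AtPrime 𝔫)) ^ 2 →
            iotaOrd (Localization.AtPrime 𝔫) (algebraMap (cobordantAlgebra' u w) (Localization.AtPrime 𝔫) g) <
              iotaOrd S f := by
  by_cases hA : ∃ (v g : S) (ν : ℕ), IsUnit v ∧ g ∈ maximalIdeal S ∧ g ∉ maximalIdeal S ^ 2 ∧ f = v * g ^ ν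
  · obtain ⟨v, g, ν, hv, hg, hg2, hfe⟩ := hA
    exact canonicalGameBody_of_eq_unit_mul_pow S (LocalGameEFTDimTwo.spanFinrank_eq_two hdim) hv hg hg2 hfe hf2
  · exact canonicalGameBody_of_not_isMonomialType S k₀ hdim f hf0 hf2 hA

/-! ### The conjunct of the P2 rung -/

/-- **ORDER (o24-G): the conjunct `CanonicalGameClauseLE2 p iotaOrd jContact` of the P2 rung `P2Rung p iotaOrd jContact`**
(`…EFT4SDimLETwo`, p512950), for every `p`: res-type-025's combinator `canonicalGameClauseLE2_iotaOrd_of_dimTwo`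
(Krull dimension `≤ 1` from the P1 rung p510636 with 092's `jContact_isoInvariant` / `jContact_eq_pow_of_DVR`) applied to the
dimension-two body `canonicalGameBody_iotaOrd_jContact_of_ringKrullDim_eq_two`. The `hgame` input of 073's
`p2Rung_iotaOrd_of_pieces` / `forall_p2Rung_iotaOrd_of_pieces`. [OURS · L1 W4.3 · (o24-G)] -/
theorem canonicalGameClauseLE2_iotaOrd_jContact (p : ℕ) : CanonicalGameClauseLE2 p iotaOrd jContact :=
  LocalGameEFT4SDimLETwo.canonicalGameClauseLE2_iotaOrd_of_dimTwo p jContact jContact_isoInvariant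
    (fun R _ _ _ g hg0 hg m => jContact_eq_pow_of_DVR R g hg0 hg m)
    (fun k₀ _ _ _ S _ _ _ _ f hdim hf0 hf2 =>
      canonicalGameBody_iotaOrd_jContact_of_ringKrullDim_eq_two k₀ S f hdim hf0 hf2)

end LocalGameEFTDimTwoGame

end Summit.ResolutionOfSingularities.ResolutionOfSingularities.Theorems

end
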